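import Summits.BirchSwinnertonDyer.BirchSwinnertonDyer.Theorems.ManinLocalTwoThreeTypeThreePsiThreeNewtonPolygon
import Summits.BirchSwinnertonDyer.Rank1Residual.Additive.GordIsogenyInvarianceClasses
import Literature.NumberTheory.EllipticCurves.PAdicHeightsTateValuationProofs
import Literature.NumberTheory.EllipticCurves.NeronLocalHeightCompletion
import Literature.NumberTheory.Automorphic.ShimuraCurveRibetTakahashiOptimalProofs
import Mathlib.RingTheory.Polynomial.RationalRoot
import HarnessLib

/-!
# The tame Néron-scalar law at `3` on the `III*` stratum, for a RATIONAL `3`-line: the `u = 1` Vélu pair is never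
# a minimal pair (E-an-108 `TameThreeNeronScalarLawIIIstar`, conjunct 1, PROVED by explicit `3`-adic computation)

Summit `BirchSwinnertonDyer`, route `ManinLocalTwoThree` (cell bsd-f2-manin), crux C3 `ManinPrimeToThreeAtNine`
(stmt-BirchSwinnertonDyer-22968); the local input of the an planner's Γ₀/Γ₁ TRIPLING ledger at `9p` (MEMO-an §66,
HOME/an/Sketch-an-g24.lean, kernel edge `notTripled_nineMulPrime_of_typeIIIstar` over p3's
`velu_three_of_tripled_nine_mul_prime`).  THE STATEMENT (`not_exists_isGloballyMinimal_velu_three_of_IIIstar`): let `W/ℚ`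
be globally minimal, TAME at `3` (`9 ∥ N`), with `ord₃ Δ_min = 9` and `ord₃ j ≥ 0` (Kodaira type `III*`, potentially good),
and let `q ∈ ℚ` be the short-model abscissa of a rational `3`-line, `Ψ₃(q − b₂/12) = 0`.  Then NO globally minimal `W'/ℚ`
has `c₄(W') = 1440q² − 9c₄(W)` and `c₆(W') = 60480q³ − 756c₄(W)q − 27c₆(W)` — the `u = 1` Vélu pair of `W/C` is
`(3⁴c₄″, 3⁶c₆″)` for a `3`-INTEGRAL pair `(c₄″, c₆″)` realised by an explicit `3`-integral Weierstrass model, so a globally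
minimal curve with the Vélu pair would have a `3`-integral model of discriminant `3⁻¹²Δ_min` (E-an-108's `u(W → W/C) = 3`;
it fills, over `ℚ₃` and for rational kernels, the «?» of Dokchitser–Dokchitser 2015 Table 1, row pot.-good `l = p`, on `III*`).

THE PROOF (Tate + Vélu, no Néron models, no Gealy–Klagsbrun input):
* §1 `kodairaSymbolAt_placeOf_three_eq_IIIstar`: Ogg (`f = ord Δ_min + 1 − m`) gives `m = 8`, i.e. `I₈`, `I₃*` or `III*`;
  `I₈` has `ord Δ_min = 8`, `I₃*` has `ord₃ j < 0` (`one_lt_valuation_j_of_kodairaSymbolAt_eq_Istar_succ`).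
* §2 `exists_IIIstarShape_coeffs_three`: the tree's K2 bridge (`GaloisImage.exists_IIIstarShape_intModel_three'`) read on
  integers: `b₂(W) = 9β − 12r`, `b₄(W) = 27γ − 9βr + 6r²`, `b₆(W) = 243δ − 54γr + 9βr² − 4r³` with `3 ∤ γ` and
  `4ε = 3βδ − γ²` (`b₈` of the translate is `729ε`).
* §3 the rational root: with `y = 4q − 3β`, `Ψ₃(q − b₂/12) = 0` reads `y⁴ + 12βy³ + 432γy² + 15552δy + 62208ε = 0`
  (monic ⟹ `y ∈ ℤ`); `3 ∣ y`, `y = 3z`, `3 ∤ z` (as `3 ∤ ε`), and `z³(z + 4β) ≡ 0` gives `z + β = 3σ`; so `q = 9σ/4`.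
* §4 the `3`-local form of «a globally minimal model minimises `ord_p Δ` among `p`-integral models»
  (`padicValInt_minimalDiscriminantInt_le_padicValRat_Δ_smul_of_den`, after p625050/`…AtMostOneBlindRoot`).
* §5 the explicit model `M = [0, 3σ/4, 0, −3A/16, −(B + 8σA)/64]`, `A = 6σz − z² + 8γ`, `B = −2z³ + 9σz² + 24γz + 144δ`:
  `3⁴c₄(M) = 1440q² − 9c₄(W)`, `3⁶c₆(M) = 60480q³ − 756c₄(W)q − 27c₆(W)` (ring identities), `M` is `3`-integral; hence
  the main theorem, and its reading `natAbs ≠`-free for the ledger.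

HONEST FRAMING: a LOCAL theorem about Weierstrass models; C3, Manin's conjecture and BSD are not proved.  No definitions,
no named facts, no sorry.  Sanity instance: `36a3 = [0,0,0,0,−27]` (III*), `q = 0`, Vélu pair `(0, −629856)` =
`(3⁴·0, 3⁶·(−864))`, `M = [0,0,0,0,1] = 36a1` (III).

References: [SilvermanATAEC1994] IV.9.4 Steps 6–9, Table 4.1; [SilvermanAEC2009] III.1 Table 3.1, VII.1;
J. Vélu, C. R. Acad. Sci. Paris 273 (1971) 238–241; [DokchitserDokchitser2015LocalInvariants] Table 1; cell memo
HOME/MEMO-an.md §66 (E-an-107/108, census HOME/an/g24/tame3-neron-census.out: 8 650/8 650 `III* → III` edges, `u = 3`).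
-/

set_option linter.dupNamespace false
set_option autoImplicit false

noncomputable section

open scoped Classical

open WeierstrassCurve IsDedekindDomain NumberField Rat.HeightOneSpectrum Polynomial
  Literature.NumberTheory.DiophantineGeometry Literature.NumberTheory.EllipticCurves
  Summit.BirchSwinnertonDyer.Rank1Residual.Additive

namespace Summit.BirchSwinnertonDyer.BirchSwinnertonDyer.Theorems.ManinLocalTwoThree

/-! ### §1. `9 ∥ N`, `ord₃ Δ_min = 9`, `ord₃ j ≥ 0` give Kodaira type `III*` at `3` -/

/-- The place `placeOf 3` of `ℤ` lies over the rational prime `3`. -/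
private theorem natGenerator_placeOf_three' : natGenerator (placeOf 3) = 3 :=
  congrArg Subtype.val ((primesEquiv (R := ℤ)).apply_symm_apply ⟨3, Nat.prime_three⟩)

/-- **`9 ∥ N`, `ord₃ Δ_min = 9` and `ord₃ j ≥ 0` force Kodaira type `III*` at `3`.**  Ogg's formula (the tree's
definition of `conductorExponent`) gives `m = ord Δ_min + 1 − f = 8` components: `I₈`, `I₃*` or `III*`; `I₈` is
multiplicative with `ord Δ_min = 8` (`kodairaSymbolAt_eq_I_iff_holds`), and `I₃*` is potentially multiplicative,
`ord₃ j < 0` (`one_lt_valuation_j_of_kodairaSymbolAt_eq_Istar_succ`).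
[cite: SilvermanATAEC1994, IV.9.4 Table 4.1 and IV.11.1 (Ogg's formula)] -/
theorem kodairaSymbolAt_placeOf_three_eq_IIIstar (W : WeierstrassCurve ℚ) [W.IsElliptic]
    [W.IsGloballyMinimal] (h9 : 3 ^ 2 ∣ W.conductorNorm ℤ) (h27 : ¬ 3 ^ 3 ∣ W.conductorNorm ℤ)
    (hΔ : padicValInt 3 W.minimalDiscriminantInt = 9) (hj : 0 ≤ padicValRat 3 W.j) :
    W.kodairaSymbolAt (placeOf 3) = .IIIstar := by
  have hN0 : W.conductorNorm ℤ ≠ 0 := fun h ↦ h27 (h ▸ dvd_zero _)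
  have hf : (W.conductorNorm ℤ).factorization 3 = 2 := by
    have h2 : 2 ≤ (W.conductorNorm ℤ).factorization 3 :=
      (Nat.prime_three.pow_dvd_iff_le_factorization hN0).mp h9
    have h3 : ¬ 3 ≤ (W.conductorNorm ℤ).factorization 3 := fun h ↦
      h27 ((Nat.prime_three.pow_dvd_iff_le_factorization hN0).mpr h)
    omega
  have hcond : W.conductorExponent (placeOf 3) = 2 := by
    rw [← hf]; exact (factorization_conductorNorm_primesEquiv_symm W ⟨3, Nat.prime_three⟩).symm
  have hord : W.ordMinimalDiscriminant (placeOf 3) = 9 := by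
    rw [ordMinimalDiscriminant_placeOf_eq]; exact_mod_cast hΔ
  have hm : (W.kodairaSymbolAt (placeOf 3)).numComponents = 8 := by
    unfold WeierstrassCurve.conductorExponent WeierstrassCurve.numComponentsAt at hcond
    omega
  have key : ∀ s : KodairaSymbol, s.numComponents = 8 → s = .I 8 ∨ s = .Istar 3 ∨ s = .IIIstar := by
    rintro ((_ | n) | _ | _ | _ | n | _ | _ | _) hs <;>
      simp only [KodairaSymbol.numComponents] at hs
    all_goals first
      | omega
      | exact Or.inr (Or.inr rfl)
      | (obtain rfl : n = 7 := by omega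
         exact Or.inl rfl)
      | (obtain rfl : n = 3 := by omega
         exact Or.inr (Or.inl rfl))
  rcases key _ hm with h8 | h3 | hIII
  · -- `I₈` is multiplicative with `ord₃ Δ_min = 8`
    have := ((kodairaSymbolAt_eq_I_iff_holds (placeOf 3) W) (by norm_num : (8 : ℕ) ≠ 0)).mp h8
    omega
  · -- `I₃*` is potentially multiplicative: `ord₃ j < 0`
    exfalso
    haveI : PerfectField (IsLocalRing.ResidueField ((placeOf 3).adicCompletionIntegers ℚ)) :=
      PerfectField.ofFinite
    have h2 : ringChar (ℤ ⧸ (placeOf 3).asIdeal) ≠ 2 := by rw [ringChar_int_quot_placeOf 3]; decide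
    have hlt := W.one_lt_valuation_j_of_kodairaSymbolAt_eq_Istar_succ (placeOf 3) h2 h3
    by_cases hj0 : W.j = 0
    · rw [hj0, map_zero] at hlt
      exact not_lt_of_ge zero_le_one hlt
    rw [valuation_eq_exp_neg_padicValRat (placeOf 3) hj0, natGenerator_placeOf_three',
      show (1 : WithZero (Multiplicative ℤ)) = WithZero.exp 0 from rfl, WithZero.exp_lt_exp] at hlt
    omega
  · exact hIII

/-! ### §2. The integer `III*`-shape translate of the global minimal model -/

/-- **Tate's normal form of type `III*`, integer version.**  For a globally minimal `W/ℚ` with `9 ∥ N`,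
`ord₃ Δ_min = 9`, `ord₃ j ≥ 0` there are integers `r, β, γ, δ, ε` with `3 ∤ γ` and `4ε = 3βδ − γ²` such that the
translate `x ↦ x + r` has `b₂ = 9β`, `b₄ = 27γ`, `b₆ = 243δ`, `b₈ = 729ε`; equivalently `b₂(W) = 9β − 12r`,
`b₄(W) = 27γ − 9βr + 6r²`, `b₆(W) = 243δ − 54γr + 9βr² − 4r³`, `b₈(W) = 729ε − 729δr + 81γr² − 9βr³ + 3r⁴`
(tree K2 bridge `GaloisImage.exists_IIIstarShape_intModel_three'`: `9 ∣ b₂`, `27 ∥ b₄`, `243 ∣ b₆`; then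
`4b₈ = b₂b₆ − b₄²`).  [cite: SilvermanATAEC1994, IV.9.4 Steps 6–9 (type III*)] -/
theorem exists_IIIstarShape_coeffs_three (W : WeierstrassCurve ℚ) [W.IsElliptic] [W.IsGloballyMinimal]
    (h9 : 3 ^ 2 ∣ W.conductorNorm ℤ) (h27 : ¬ 3 ^ 3 ∣ W.conductorNorm ℤ)
    (hΔ : padicValInt 3 W.minimalDiscriminantInt = 9) (hj : 0 ≤ padicValRat 3 W.j) :
    ∃ r β γ δ ε : ℤ, ¬ (3 : ℤ) ∣ γ ∧ 4 * ε = 3 * β * δ - γ ^ 2 ∧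
      W.b₂ = 9 * β - 12 * r ∧ W.b₄ = 27 * γ - 9 * β * r + 6 * r ^ 2 ∧
      W.b₆ = 243 * δ - 54 * γ * r + 9 * β * r ^ 2 - 4 * r ^ 3 ∧
      W.b₈ = 729 * ε - 729 * δ * r + 81 * γ * r ^ 2 - 9 * β * r ^ 3 + 3 * r ^ 4 := by
  obtain ⟨V, ⟨r, -, hV⟩, hb₂, hb₄, hb₄', hb₆, -, -⟩ :=
    Summit.BirchSwinnertonDyer.Rank1Residual.GaloisImage.exists_IIIstarShape_intModel_three' (placeOf 3) W
      natGenerator_placeOf_three'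
      (kodairaSymbolAt_placeOf_three_eq_IIIstar W h9 h27 hΔ hj)
  have h₂ := congrArg WeierstrassCurve.b₂ hV
  have h₄ := congrArg WeierstrassCurve.b₄ hV
  have h₆ := congrArg WeierstrassCurve.b₆ hV
  have h₈ := congrArg WeierstrassCurve.b₈ hV
  simp only [map_b₂, map_b₄, map_b₆, map_b₈, eq_intCast, variableChange_b₂, variableChange_b₄,
    variableChange_b₆, variableChange_b₈, inv_one, Units.val_one, one_pow, one_mul] at h₂ h₄ h₆ h₈
  obtain ⟨β, hβ⟩ := hb₂
  obtain ⟨γ, hγ⟩ := hb₄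
  obtain ⟨δ, hδ⟩ := hb₆
  -- `b₈ = 729 ε` with `4ε = 3βδ − γ²`, from `4 b₈ = b₂ b₆ − b₄²`
  have hrel := V.b_relation
  have h729 : (729 : ℤ) ∣ V.b₈ := by
    have : (729 : ℤ) ∣ V.b₈ * 4 := ⟨3 * β * δ - γ ^ 2, by rw [mul_comm, hrel, hβ, hγ, hδ]; ring⟩
    exact (show IsCoprime (729 : ℤ) 4 from ⟨1, -182, by norm_num⟩).dvd_of_dvd_mul_right this
  obtain ⟨ε, hε⟩ := h729
  have hε4 : 4 * ε = 3 * β * δ - γ ^ 2 := by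
    have e : 4 * V.b₈ = V.b₂ * V.b₆ - V.b₄ ^ 2 := hrel
    rw [hε, hβ, hγ, hδ] at e
    have e' : (729 : ℤ) * (4 * ε) = 729 * (3 * β * δ - γ ^ 2) := by linear_combination e
    exact mul_left_cancel₀ (by norm_num : (729 : ℤ) ≠ 0) e'
  have hγ3 : ¬ (3 : ℤ) ∣ γ := by
    rintro ⟨μ, hμ⟩
    exact hb₄' ⟨μ, by rw [hγ, hμ]; ring⟩
  refine ⟨r, β, γ, δ, ε, hγ3, hε4, ?_, ?_, ?_, ?_⟩
  · rw [hβ] at h₂; push_cast at h₂; linear_combination -h₂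
  · rw [hγ] at h₄; rw [hβ] at h₂; push_cast at h₂ h₄; linear_combination -h₄ + (r : ℚ) * h₂
  · rw [hδ] at h₆; rw [hγ] at h₄; rw [hβ] at h₂; push_cast at h₂ h₄ h₆
    linear_combination -h₆ + 2 * (r : ℚ) * h₄ - (r : ℚ) ^ 2 * h₂
  · rw [hε] at h₈; rw [hδ] at h₆; rw [hγ] at h₄; rw [hβ] at h₂; push_cast at h₂ h₄ h₆ h₈
    linear_combination -h₈ + 3 * (r : ℚ) * h₆ - 3 * (r : ℚ) ^ 2 * h₄ + (r : ℚ) ^ 3 * h₂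


/-! ### §3. A globally minimal model minimises `ord_p Δ` among `p`-integral models (`3`-local form) -/

/-- **A globally minimal model minimises `ord_p Δ` among all `p`-INTEGRAL models** (local form of p625050's
`padicValInt_minimalDiscriminantInt_le_padicValRat_Δ_smul`): if `W/ℚ` is globally minimal and `C • W` has coefficients
`nᵢ / m` with `m` prime to `p`, then `ord_p Δ_min(W) ≤ ord_p Δ(C • W)` (`W ⊗ ℚ_p` is `ℤ_p`-minimal,
`isMinimal_baseChange_padic_of_isGloballyMinimal`, and `(C • W) ⊗ ℚ_p` is a `ℤ_p`-integral equation isomorphic to it).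
[cite: SilvermanAEC2009, VII.1 (minimal equations) and VIII.8] -/
theorem padicValInt_minimalDiscriminantInt_le_padicValRat_Δ_smul_of_den (W : WeierstrassCurve ℚ) [W.IsElliptic]
    [W.IsGloballyMinimal] (C : VariableChange ℚ) (p : ℕ) [hp : Fact p.Prime] (m : ℤ) (hm : ¬ (p : ℤ) ∣ m)
    (n₁ n₂ n₃ n₄ n₆ : ℤ) (h₁ : (m : ℚ) * (C • W).a₁ = n₁) (h₂ : (m : ℚ) * (C • W).a₂ = n₂)
    (h₃ : (m : ℚ) * (C • W).a₃ = n₃) (h₄ : (m : ℚ) * (C • W).a₄ = n₄) (h₆ : (m : ℚ) * (C • W).a₆ = n₆) :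
    (padicValInt p W.minimalDiscriminantInt : ℤ) ≤ padicValRat p (C • W).Δ := by
  obtain ⟨v, hv⟩ := (Rat.HeightOneSpectrum.primesEquiv (R := 𝓞 ℚ)).surjective ⟨p, hp.out⟩
  have hvp : ((Rat.HeightOneSpectrum.primesEquiv v : Nat.Primes) : ℕ) = p := congrArg Subtype.val hv
  subst hvp
  haveI hmin := isMinimal_baseChange_padic_of_isGloballyMinimal W v
  set p : ℕ := ((Rat.HeightOneSpectrum.primesEquiv v : Nat.Primes) : ℕ) with hpdef
  set X : WeierstrassCurve ℚ_[p] := W.baseChange ℚ_[p] with hX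
  set Y : WeierstrassCurve ℚ_[p] := (C • W).baseChange ℚ_[p] with hY
  have hYX : Y = (C.map (algebraMap ℚ ℚ_[p])) • X := by
    rw [hY, hX, baseChange, baseChange, map_variableChange]
  -- `m` is a `p`-adic unit, so `nᵢ / m ∈ ℤ_p`
  have hm0 : (m : ℚ) ≠ 0 := by
    rintro h
    exact hm (by rw [show m = 0 by exact_mod_cast h]; exact dvd_zero _)
  have hmn : ‖((m : ℚ) : ℚ_[p])‖ = 1 := by
    rw [Rat.cast_intCast]
    exact le_antisymm (Padic.norm_int_le_one m)
      (not_lt.mp fun h ↦ hm (Padic.norm_intCast_lt_one_iff.mp h))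
  have lift : ∀ (a : ℚ) (n : ℤ), (m : ℚ) * a = n → ∃ r : ℤ_[p], algebraMap ℤ_[p] ℚ_[p] r = (a : ℚ_[p]) := by
    intro a n ha
    have ha' : a = (n : ℚ) / m := by rw [← ha]; field_simp
    have hnorm : ‖(a : ℚ_[p])‖ ≤ 1 := by
      rw [ha', Rat.cast_div, norm_div, hmn, div_one, Rat.cast_intCast]
      exact Padic.norm_int_le_one n
    exact ⟨⟨(a : ℚ_[p]), hnorm⟩, rfl⟩
  haveI hYint : Y.IsIntegral ℤ_[p] := by
    refine isIntegral_of_exists_lift ℤ_[p] ?_ ?_ ?_ ?_ ?_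
    · simpa [hY, baseChange] using lift _ _ h₁
    · simpa [hY, baseChange] using lift _ _ h₂
    · simpa [hY, baseChange] using lift _ _ h₃
    · simpa [hY, baseChange] using lift _ _ h₄
    · simpa [hY, baseChange] using lift _ _ h₆
  have hle : Padic.mulValuation Y.Δ ≤ Padic.mulValuation X.Δ := by
    have := ((isMinimal_iff_of_le_one_iff (padicMulValuation_le_one_iff (p := p)) X).mp hmin).2
      (C.map (algebraMap ℚ ℚ_[p])) (hYX ▸ hYint)
    rwa [← hYX] at this
  have hXΔ : X.Δ ≠ 0 := by
    rw [hX, baseChange, map_Δ]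
    exact (_root_.map_ne_zero _).mpr W.isUnit_Δ.ne_zero
  have hYΔ' : Y.Δ = (((C • W).Δ : ℚ) : ℚ_[p]) := by
    rw [hY, baseChange, map_Δ, eq_ratCast]
  have hCWΔ : (C • W).Δ ≠ 0 := (C • W).isUnit_Δ.ne_zero
  have hYΔ : Y.Δ ≠ 0 := by
    rw [hYΔ']
    exact_mod_cast hCWΔ
  rw [padicMulValuation_apply_of_ne_zero hYΔ, padicMulValuation_apply_of_ne_zero hXΔ,
    WithZero.exp_le_exp, neg_le_neg_iff, hX, padicValuation_Δ_baseChange_eq_padicValInt, hYΔ',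
    Padic.valuation_ratCast] at hle
  exact hle


/-! ### §4. The rational root of `Ψ₃` on the `III*` shape: `y = 4q − 3β = 3z`, `3 ∤ z`, `z + β = 3σ` -/

/-- **The `3`-adic position of a rational `3`-line on the `III*` shape.**  If `y ∈ ℚ` satisfies
`y⁴ + 12βy³ + 432γy² + 15552δy + 62208ε = 0` with `3 ∤ γ` and `4ε = 3βδ − γ²`, then `y = 3z` with `z ∈ ℤ`, `3 ∤ z`,
`z + β = 3σ` (`σ ∈ ℤ`) and `z⁴ + 4βz³ + 48γz² + 576δz + 768ε = 0`.  (Rational root of a monic integer quartic;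
then the Newton polygon by hand: `3 ∣ y`; `3 ∣ z` would force `3 ∣ ε`, i.e. `3 ∣ γ`; and `z³(z + 4β) ≡ 0 (mod 3)`.)
[cite: SilvermanATAEC1994, IV.9.4 Steps 6–9 (type III*)] -/
theorem exists_int_of_psi3IIIstar_root {β γ δ ε : ℤ} (hγ : ¬ (3 : ℤ) ∣ γ) (hε : 4 * ε = 3 * β * δ - γ ^ 2)
    {y : ℚ} (hy : y ^ 4 + 12 * β * y ^ 3 + 432 * γ * y ^ 2 + 15552 * δ * y + 62208 * ε = 0) :
    ∃ z σ : ℤ, y = 3 * (z : ℚ) ∧ z + β = 3 * σ ∧ ¬ (3 : ℤ) ∣ z ∧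
      z ^ 4 + 4 * β * z ^ 3 + 48 * γ * z ^ 2 + 576 * δ * z + 768 * ε = 0 := by
  -- `y` is an integer: rational root of a monic integer polynomial
  set P : ℤ[X] := X ^ 4 + (C (12 * β) * X ^ 3 + C (432 * γ) * X ^ 2 + C (15552 * δ) * X + C (62208 * ε))
    with hP
  have hmonic : P.Monic := by
    refine (monic_X_pow 4).add_of_left (lt_of_le_of_lt degree_cubic_le ?_)
    rw [degree_X_pow]; norm_num
  have haeval : aeval y P = 0 := by
    rw [← hy, hP]
    simp only [map_add, map_mul, map_pow, aeval_X, map_ofNat, map_intCast, eq_intCast]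
    ring
  obtain ⟨Y, hY⟩ := isInteger_of_is_root_of_monic hmonic haeval
  have hYy : (Y : ℚ) = y := by simpa using hY
  have hYeq : Y ^ 4 + 12 * β * Y ^ 3 + 432 * γ * Y ^ 2 + 15552 * δ * Y + 62208 * ε = 0 := by
    have h : ((Y ^ 4 + 12 * β * Y ^ 3 + 432 * γ * Y ^ 2 + 15552 * δ * Y + 62208 * ε : ℤ) : ℚ) = 0 := by
      push_cast; rw [hYy]; exact hy
    exact_mod_cast h
  -- `3 ∣ Y`
  have h3Y : (3 : ℤ) ∣ Y := by
    refine Int.prime_three.dvd_of_dvd_pow (n := 4) ⟨-(4 * β * Y ^ 3 + 144 * γ * Y ^ 2 + 5184 * δ * Y + 20736 * ε), ?_⟩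
    linear_combination hYeq
  obtain ⟨z, rfl⟩ := h3Y
  have hzeq : z ^ 4 + 4 * β * z ^ 3 + 48 * γ * z ^ 2 + 576 * δ * z + 768 * ε = 0 := by
    have h : (81 : ℤ) * (z ^ 4 + 4 * β * z ^ 3 + 48 * γ * z ^ 2 + 576 * δ * z + 768 * ε) = 0 := by
      linear_combination hYeq
    exact (mul_eq_zero.mp h).resolve_left (by norm_num)
  -- `3 ∤ z` (else `3 ∣ ε`, `3 ∣ γ² `, `3 ∣ γ`)
  have hz3 : ¬ (3 : ℤ) ∣ z := by
    rintro ⟨w, rfl⟩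
    have hε3 : (3 : ℤ) ∣ ε := by
      have h : 768 * ε = -9 * (9 * w ^ 4 + 12 * β * w ^ 3 + 48 * γ * w ^ 2 + 192 * δ * w) := by
        linear_combination hzeq
      omega
    obtain ⟨j, hj⟩ := hε3
    exact hγ (Int.prime_three.dvd_of_dvd_pow (n := 2) ⟨β * δ - 4 * j, by linear_combination hε - 4 * hj⟩)
  -- `3 ∣ z + 4β`
  have h3 : (3 : ℤ) ∣ z ^ 3 * (z + 4 * β) :=
    ⟨-(16 * γ * z ^ 2 + 192 * δ * z + 256 * ε), by linear_combination hzeq⟩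
  rcases Int.prime_three.dvd_or_dvd h3 with h | h
  · exact absurd (Int.prime_three.dvd_of_dvd_pow h) hz3
  obtain ⟨κ, hκ⟩ := h
  refine ⟨z, κ - β, by rw [← hYy]; push_cast; ring, by linear_combination hκ, hz3, hzeq⟩

/-! ### §5. The explicit `3`-integral model below the Vélu pair, and the law -/

/-- **E-an-108 `TameThreeNeronScalarLawIIIstar`, conjunct 1 (cell bsd-f2-manin, MEMO-an §66; census 8 650 / 8 650
`III* → III` rational `3`-isogenies at `v₃N = 2`, all `u = 3`): on a globally minimal `W/ℚ`, TAME at `3` (`9 ∥ N`) with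
`ord₃ Δ_min = 9` and `ord₃ j ≥ 0` (pot.-good `III*`), for every rational `3`-line (short-model abscissa `q`,
`Ψ₃(q − b₂/12) = 0`) the `u = 1` Vélu pair `(1440q² − 9c₄, 60480q³ − 756c₄q − 27c₆)` is NOT the `(c₄, c₆)` of a
globally minimal curve.**  Proof: §2–§4 give `q = 9σ/4`, `β = 3σ − z` and the `3`-integral model
`M = [0, 3σ/4, 0, −3A/16, −(B + 8σA)/64]` (`A = 6σz − z² + 8γ`, `B = −2z³ + 9σz² + 24γz + 144δ`) with
`(3⁴c₄(M), 3⁶c₆(M))` = the Vélu pair; a globally minimal `W'` with the Vélu pair is `ℚ`-isomorphic to `M`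
(`exists_variableChange_of_c₄_eq_of_c₆_eq`), and §3 gives `ord₃ Δ_min(W') ≤ ord₃ Δ(M) = ord₃ Δ(W') − 12`, absurd.
[cite: SilvermanATAEC1994, IV.9.4 Steps 6–9 and Table 4.1] [cite: SilvermanAEC2009, III.1 Table 3.1 and VII.1] -/
theorem not_exists_isGloballyMinimal_velu_three_of_IIIstar (W : WeierstrassCurve ℚ) [W.IsElliptic]
    [W.IsGloballyMinimal] (h9 : 3 ^ 2 ∣ W.conductorNorm ℤ) (h27 : ¬ 3 ^ 3 ∣ W.conductorNorm ℤ)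
    (hΔ : padicValInt 3 W.minimalDiscriminantInt = 9) (hj : 0 ≤ padicValRat 3 W.j)
    (q : ℚ) (hq : W.Ψ₃.eval (q - W.b₂ / 12) = 0) :
    ¬ ∃ W' : WeierstrassCurve ℚ, W'.IsElliptic ∧ W'.IsGloballyMinimal ∧
        W'.c₄ = 1440 * q ^ 2 - 9 * W.c₄ ∧ W'.c₆ = 60480 * q ^ 3 - 756 * W.c₄ * q - 27 * W.c₆ := by
  rintro ⟨W', _, _, h4, h6⟩
  obtain ⟨r, β, γ, δ, ε, hγ, hε, hb₂, hb₄, hb₆, hb₈⟩ := exists_IIIstarShape_coeffs_three W h9 h27 hΔ hj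
  -- the invariants of `W`
  have hc₄ : W.c₄ = 81 * ((β : ℚ) ^ 2 - 8 * γ) := by
    simp only [WeierstrassCurve.c₄]; rw [hb₂, hb₄]; ring
  have hc₆ : W.c₆ = -729 * ((β : ℚ) ^ 3 - 12 * β * γ + 72 * δ) := by
    simp only [WeierstrassCurve.c₆]; rw [hb₂, hb₄, hb₆]; ring
  -- the root, rescaled: `y = 4q − 3β`
  have hy : (4 * q - 3 * β) ^ 4 + 12 * β * (4 * q - 3 * β) ^ 3 + 432 * γ * (4 * q - 3 * β) ^ 2 +
      15552 * δ * (4 * q - 3 * β) + 62208 * ε = 0 := by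
    simp only [WeierstrassCurve.Ψ₃, eval_add, eval_mul, eval_pow, eval_C, eval_X, eval_ofNat] at hq
    rw [hb₂, hb₄, hb₆, hb₈] at hq
    have hε' : (4 * ε : ℚ) = 3 * β * δ - γ ^ 2 := by exact_mod_cast hε
    linear_combination (256 / 3 : ℚ) * hq + 5184 * hε' - 5184 * hε'
  obtain ⟨z, σ, hyz, hσ, hz3, hzeq⟩ := exists_int_of_psi3IIIstar_root hγ hε hy
  have hq' : q = 9 * (σ : ℚ) / 4 := by
    have hσ' : ((z + β : ℤ) : ℚ) = 3 * σ := by exact_mod_cast hσ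
    push_cast at hσ'
    linear_combination hyz / 4 + 3 * hσ' / 4
  have hβ : (β : ℚ) = 3 * σ - z := by
    have hσ' : ((z + β : ℤ) : ℚ) = 3 * σ := by exact_mod_cast hσ
    push_cast at hσ'
    linear_combination hσ'
  -- the explicit model
  set A : ℤ := 6 * σ * z - z ^ 2 + 8 * γ with hA
  set B : ℤ := -2 * z ^ 3 + 9 * σ * z ^ 2 + 24 * γ * z + 144 * δ with hB
  set M : WeierstrassCurve ℚ := ⟨0, 3 * σ / 4, 0, -3 * (A : ℚ) / 16, -((B : ℚ) + 8 * σ * A) / 64⟩ with hM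
  have hM₄ : M.c₄ = (3 ^ 4)⁻¹ * W'.c₄ := by
    rw [h4, hc₄, hq', hβ]
    simp only [hM, WeierstrassCurve.c₄, WeierstrassCurve.b₂, WeierstrassCurve.b₄, hA]
    push_cast; ring
  have hM₆ : M.c₆ = (3 ^ 6)⁻¹ * W'.c₆ := by
    rw [h6, hc₄, hc₆, hq', hβ]
    simp only [hM, WeierstrassCurve.c₆, WeierstrassCurve.b₂, WeierstrassCurve.b₄, WeierstrassCurve.b₆, hA, hB]
    push_cast; ring
  obtain ⟨C, hC⟩ := Literature.NumberTheory.EllipticCurves.ModularForms.exists_variableChange_of_c₄_eq_of_c₆_eq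
    (W₁ := W') (W₂ := M) (w := 3) three_ne_zero hM₄ hM₆
  -- `M` is `3`-integral: minimality of `W'` at `3`
  haveI : Fact (Nat.Prime 3) := ⟨Nat.prime_three⟩
  have hle := padicValInt_minimalDiscriminantInt_le_padicValRat_Δ_smul_of_den W' C 3 64 (by norm_num)
    0 (48 * σ) 0 (-12 * A) (-(B + 8 * σ * A))
    (by rw [hC, hM]; push_cast; ring) (by rw [hC, hM]; push_cast; ring) (by rw [hC, hM]; push_cast; ring)
    (by rw [hC, hM]; push_cast; ring) (by rw [hC, hM]; push_cast; ring)
  -- but `Δ(M) = 3⁻¹² Δ(W') = 3⁻¹² Δ_min(W')`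
  have hΔM : (C • W').Δ = (3 : ℚ)⁻¹ ^ 12 * (W'.minimalDiscriminantInt : ℚ) := by
    rw [hC, cast_minimalDiscriminantInt]
    have h1 := M.c_relation
    have h2 := W'.c_relation
    rw [hM₄, hM₆] at h1
    linear_combination h1 / 1728 - h2 / (1728 * 3 ^ 12)
  have hm0 : (W'.minimalDiscriminantInt : ℚ) ≠ 0 := by exact_mod_cast minimalDiscriminantInt_ne_zero W'
  rw [hΔM, padicValRat.mul (pow_ne_zero _ (inv_ne_zero three_ne_zero)) hm0, padicValRat.pow,
    padicValRat.inv, padicValRat.of_int] at hle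
  have h3v : padicValRat 3 (3 : ℚ) = 1 := by exact_mod_cast padicValRat.self (p := 3) (by norm_num)
  rw [h3v] at hle
  push_cast at hle
  linarith

end Summit.BirchSwinnertonDyer.BirchSwinnertonDyer.Theorems.ManinLocalTwoThree

end
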